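import Summits.ResolutionOfSingularities.ResolutionOfSingularities.Theorems.EquisingularLiftEquisingularLiftNatSecondOrderALadder
import HarnessLib

/-!
# [OURS] GRAPH CHARTS CARRY (TRIVIAL) SECOND-ORDER DATA: a strict transform `G ≡ T_j (mod T_l)` splits as `Φ' + Ψ'` with `Φ' = T_j + c·T_l` a non-zero
# LINEAR form and carries one-step data at its (regular) origin — the `hsec` input of ✓ `OneStep.twoStepAt_origin` / ✓ `twoStepAt_vertex` for the charts
# of an `A`-type point in which nothing happens (cruxes `Theses.EquisingularLift.EquisingularLiftNat` / `…NatThree` / `EquisingularLift`, stmt-…-20038 / -20148 / -15660)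

[OURS · leafhand-res-equisingularlift-11 g0, 2026-08-31; cell `pub/decomp-res`] AI-produced, weaker than expert review; NOT a statement of any manuscript;
nothing here proves resolution of singularities in positive characteristic.  DEF-FREE helper; no `sorry`; standard axioms; ZERO named hypotheses.

The scheme-side two-step theorems (✓ `OneStep.twoStepAt_origin`, p833573; ✓ `twoStepAt_vertex`) ask, for every chart whose origin lies on the strict transform,
a second-order splitting `G_a = Φ'_a + Ψ'_a` (`Φ'_a ≠ 0` a form of degree `μ' ≥ 1`, `Ψ'_a ∈ (T)^{μ'+1}`) with one-step data (hone').  For the GRAPH charts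
of ✓ `SecondOrderPoint.strictTransform_A_chart₀/₁` (`G - T_j ∈ (T_l)`, `j ≠ l`) the origin is a regular point of the strict transform and the datum is
trivial but must be supplied; this file supplies it once and for all:

* `SecondOrderPoint.firstOrder_linear` — (FO) for a linear form `Φ'` with `∂_jΦ' = 1`: vacuous (no prime contains `1`);
* ★ `SecondOrderPoint.secondOrderData_of_graphChart` — `G - T_j ∈ (T_l)`, `j ≠ l` ⟹ `∃ μ' = 1, Φ', Ψ'`: `Φ' = T_j + c·T_l` (`c` the constant term of the
  cofactor), `Φ' ≠ 0` homogeneous of degree `1`, `Ψ' ∈ (T)²`, `G = Φ' + Ψ'`, and (hone') for `Φ' + Ψ'` in every chart direction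
  (✓ `FirstOrderPoint.exists_strictTransform` with `μ = 1`, `Ψ₁' =` the quadratic part, ✓ `exists_split_const_linear`, ✓ `sub_homogeneousComponent_mem_pow_succ`).

Honest label: pure algebra; closes no registered stub.

References: [Hartshorne1977, I Thm. 5.1, II Ex. 7.12]; through the cited tree files.
-/

set_option linter.dupNamespace false -- mandated namespace `Summit.<Summit>.<Problem>` of this single-conjunct summit

noncomputable section

open MvPolynomial

namespace Summit.ResolutionOfSingularities.ResolutionOfSingularities.Cruxes.EquisingularLiftNat.Sections

namespace SecondOrderPoint

variable (K : Type) [Field K] {n : ℕ}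

/-- **(FO) for a linear form with a unit coefficient is vacuous**: if `∂_jΦ' = 1` then no prime contains all partials of `Φ'`. [folklore] -/
theorem firstOrder_linear {Φ' : MvPolynomial (Fin n) K} (j : Fin n) (hj : pderiv j Φ' = 1) (Ψ₁ : MvPolynomial (Fin n) K)
    (P : Ideal (MvPolynomial (Fin n) K)) (hP : P.IsPrime) (_hΦ : Φ' ∈ P) (hd : ∀ i, pderiv i Φ' ∈ P) (_hΨ : Ψ₁ ∈ P)
    (i : Fin n) : (X i : MvPolynomial (Fin n) K) ∈ P := by
  exfalso
  have h := hd j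
  rw [hj] at h
  exact hP.ne_top ((Ideal.eq_top_iff_one P).mpr h)

/-- ★ **GRAPH CHARTS CARRY SECOND-ORDER DATA.**  If `G - T_j ∈ (T_l)` with `j ≠ l` (a graph chart: ✓ `strictTransform_A_chart₀/₁`), then `G = Φ' + Ψ'` with
`Φ' = T_j + c·T_l` a non-zero linear form, `Ψ' ∈ (T)²`, and `Φ' + Ψ'` has one-step data in every chart direction (its origin is a regular point).
[cite: Hartshorne1977, I Thm. 5.1, II Ex. 7.12] -/
theorem secondOrderData_of_graphChart {l j : Fin n} (hjl : j ≠ l) {G : MvPolynomial (Fin n) K}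
    (hG : G - X j ∈ Ideal.span {(X l : MvPolynomial (Fin n) K)}) :
    ∃ (μ' : ℕ) (Φ' Ψ' : MvPolynomial (Fin n) K), 1 ≤ μ' ∧ Φ'.IsHomogeneous μ' ∧ Φ' ≠ 0 ∧
      Ψ' ∈ Ideal.span (Set.range (X : Fin n → MvPolynomial (Fin n) K)) ^ (μ' + 1) ∧ G = Φ' + Ψ' ∧
      ∀ b : Fin n, ∃ G' : MvPolynomial (Fin n) K,
        aeval (fun i => X b * Function.update (X : Fin n → MvPolynomial (Fin n) K) b 1 i) (Φ' + Ψ') = X b ^ μ' * G' ∧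
        ∀ P : Ideal (MvPolynomial (Fin n) K), P.IsPrime → (X b : MvPolynomial (Fin n) K) ∈ P → G' ∈ P → ∃ i, pderiv i G' ∉ P := by
  obtain ⟨R, hR⟩ := Ideal.mem_span_singleton'.mp hG
  obtain ⟨L, p₂, hL, hp₂, hsplit⟩ := exists_split_const_linear K R
  have hXl : (X l : MvPolynomial (Fin n) K) ∈ Ideal.span (Set.range (X : Fin n → MvPolynomial (Fin n) K)) :=
    Ideal.subset_span (Set.mem_range_self l)
  -- `G = (T_j + c T_l) + (L T_l + p₂ T_l)`
  have hGeq : G = (X j + C (coeff 0 R) * X l) + (L * X l + p₂ * X l) := by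
    have h : G = X j + R * X l := by rw [hR]; ring
    have h2 : R * X l = C (coeff 0 R) * X l + (L * X l + p₂ * X l) := by
      conv_lhs => rw [hsplit]
      ring
    rw [h, h2]; ring
  -- the pieces
  have hΦ' : (X j + C (coeff 0 R) * X l : MvPolynomial (Fin n) K).IsHomogeneous 1 := by
    have h := (isHomogeneous_X K j).add ((isHomogeneous_C (Fin n) (coeff 0 R)).mul (isHomogeneous_X K l))
    simpa using h
  have hdj : pderiv j (X j + C (coeff 0 R) * X l : MvPolynomial (Fin n) K) = 1 := by
    rw [map_add, pderiv_X_self, pderiv_C_mul, pderiv_X_of_ne (Ne.symm hjl), mul_zero, add_zero]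
  have hΦ'0 : (X j + C (coeff 0 R) * X l : MvPolynomial (Fin n) K) ≠ 0 := by
    intro h
    have h1 := congrArg (pderiv j) h
    rw [hdj, map_zero] at h1
    exact one_ne_zero h1
  have hΨ₁ : (L * X l : MvPolynomial (Fin n) K).IsHomogeneous (1 + 1) := hL.mul (isHomogeneous_X K l)
  have hΨ'' : (p₂ * X l : MvPolynomial (Fin n) K) ∈ Ideal.span (Set.range (X : Fin n → MvPolynomial (Fin n) K)) ^ (1 + 2) := by
    rw [show (1 + 2 : ℕ) = 2 + 1 from rfl, pow_succ]
    exact Ideal.mul_mem_mul hp₂ hXl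
  have hΨ' : (L * X l + p₂ * X l : MvPolynomial (Fin n) K) ∈ Ideal.span (Set.range (X : Fin n → MvPolynomial (Fin n) K)) ^ (1 + 1) := by
    refine Ideal.add_mem _ ?_ (Ideal.pow_le_pow_right (by norm_num) hΨ'')
    rw [pow_succ, pow_one]
    exact Ideal.mul_mem_mul (mem_span_of_isHomogeneous_succ K hL) hXl
  refine ⟨1, X j + C (coeff 0 R) * X l, L * X l + p₂ * X l, le_rfl, hΦ', hΦ'0, hΨ', hGeq, fun b => ?_⟩
  exact FirstOrderPoint.exists_strictTransform K (X j + C (coeff 0 R) * X l) (L * X l) (p₂ * X l) hΦ' hΨ₁ hΨ''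
    (fun P hP hΦP hdP hΨP => firstOrder_linear K j hdj _ P hP hΦP hdP hΨP) b

end SecondOrderPoint

end Summit.ResolutionOfSingularities.ResolutionOfSingularities.Cruxes.EquisingularLiftNat.Sections

end
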